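import Mathlib
import HarnessLib
import Summits.HubbardSuperconductivity.HubbardSuperconductivity.Theorems.KLProgrammeKLRegimeSplitTwoLegReadingSlopes
import Summits.HubbardSuperconductivity.HubbardSuperconductivity.Theorems.KLProgrammeKLRegimeSplitTwoLegReadingSlopesFn

/-!
# Route `KLProgramme` — GEN-6 ENGINE (`KLRegimeEngineV16`, stmt-HubbardSuperconductivity-20236), two-leg stubs: READING ON A LEVEL TUBE —
# the (E3e) slope supplier and the (E3c) two-frame split need the gradient of the reading function ONLY where `|e_K| ≤` the level read

Cell `gate-hubbard-kl`, seat p1b (g7).  Context: k3c5-p1 g7's finding (STATUS 07:54:22Z, memo GLOBAL-MOMENTUM-SIZES-FINDING.md on 20236): the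
two-leg closers of record take GLOBAL gradient bounds `∀ q : Momentum, ‖D(evalM S_n) q‖ ≤ b`, and off the flat tube of the scale-`n` cutoff the
unrenormalised counterterm chain `K u_n (iω₀ − e_K − u_n K)⁻¹ K` makes such bounds unfittable at deep scales.  But every READING the slot performs
is radial and short: (E3e) compares `S(p_k⃗)` with `S` at the curve point of the SAME ray for shell momenta `|e_K(k⃗)| ≤ Λ_n`; (E3c)'s point-motion
term compares `S` at `k_F^K(θ)` and `k_F^{K′}(θ)` — the same ray again.  Along a ray the frame band is radially MONOTONE (radial transversality,
`Dtmin_mul_sub_le_rayDispersion_sub`), so the radial segment between the curve point and the point read stays in the level tube of its endpoint: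

* §1 (generic, over `…PerturbedFermiCurveTwoFrame`) `abs_level_le_of_mem_uIcc`: between the perturbed Fermi radius `t` and a window point `s`
  of the ray, `|e_δ(r)| ≤ |e_δ(s)|`; `abs_sub_le_of_norm_fderiv_onM_le_uIcc`: radial mean value for `G : FrameFn` from a gradient bound on the
  radial segment only;
* §2 (E3e) `abs_eval_latticeMomentum_sub_eval_klFermiPoint_le_of_tube` — the off-curve reading with `‖D(evalM S) q‖ ≤ b` asked only on
  `{|frameLevel μ K q| ≤ Λ}`; **`twoLegSlopes_of_fieldStrength_of_tubeGradient`** — `TwoLegSlopes R … K n` from (E3d) and a gradient bound on the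
  SHELL TUBE `{|e_K| ≤ Λ_n}` only (same fit `b ≤ cz|U|(Dt_min − 2A)` as `twoLegSlopes_of_fieldStrength_of_gradient`);
* §3 (E3c) `abs_apply_klFermiPoint_sub_le_of_frames_of_tube` — for a profile function `G : FrameFn`,
  `|G(k_F^K θ) − G′(k_F^{K′} θ)| ≤ |G(k_F^{K′} θ) − G′(k_F^{K′} θ)| + b·frameDist K K′/(Dt_min − 2A)` with `‖D(onM G)‖ ≤ b` asked only on
  `{|frameLevel μ K| ≤ frameDist K K′}` (the segment's levels lie between `0` and `e_K(k_F^{K′}θ) = (K′ − K)(k_F^{K′}θ)`).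

Proofs only; nothing about the model is asserted.  References: BGM 2006 §2.4 Lemma 2.1 (2.40), (2.36) [cite: BenfattoGiulianiMastropietro2006].
-/

noncomputable section

namespace Summit.HubbardSuperconductivity.HubbardSuperconductivity.Theorems.KLRegimeSplit

set_option linter.dupNamespace false -- summit = problem name (single-conjunct summit), D-0017

open Real Set
open Literature.MathematicalPhysics.QuantumLattice Literature.MathematicalPhysics.QuantumLattice.BandSectorCounting
open Literature.Probability.LatticeModels
open Summit.HubbardSuperconductivity.HubbardSuperconductivity.Theorems.DispersionFlow
open Summit.HubbardSuperconductivity.HubbardSuperconductivity.Theorems.PerturbedFermiCurve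
open Summit.HubbardSuperconductivity.HubbardSuperconductivity.Theorems.KLProgrammeLegKernels

/-! ## §1 Generic: the level tube along a ray is monotone; radial mean value on a segment -/

/-- **Radial mean value on a segment**: for a function frame `G` with `onM G` differentiable and `‖D(onM G)(r·dir θ)‖ ≤ b` for every `r`
between `r₁` and `r₂`, `|G(r₁·dir θ) − G(r₂·dir θ)| ≤ b·|r₁ − r₂|` (the ray's velocity has Euclidean norm `1`). -/
theorem abs_sub_le_of_norm_fderiv_onM_le_uIcc {G : FrameFn} (hd : Differentiable ℝ (onM G)) {bG : ℝ} (θ r₁ r₂ : ℝ)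
    (hb : ∀ r ∈ uIcc r₁ r₂, ‖fderiv ℝ (onM G) (WithLp.toLp 2 (r • dir θ))‖ ≤ bG) :
    |G (r₁ • dir θ) - G (r₂ • dir θ)| ≤ bG * |r₁ - r₂| := by
  set v : Momentum := WithLp.toLp 2 (dir θ) with hv
  set g : ℝ → ℝ := fun r => onM G (r • v) with hg
  have hrv : ∀ r : ℝ, r • v = WithLp.toLp 2 (r • dir θ) := fun r => by rw [hv, WithLp.toLp_smul]
  have hgr : ∀ r, g r = G (r • dir θ) := fun r => by
    simp only [hg, hrv]
    rfl
  have hinner : ∀ r : ℝ, HasDerivAt (fun r : ℝ => r • v) v r := fun r => by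
    simpa using (hasDerivAt_id r).smul_const v
  have hderiv : ∀ r ∈ uIcc r₁ r₂, HasDerivWithinAt g (fderiv ℝ (onM G) (r • v) v) (uIcc r₁ r₂) r := fun r _ => by
    have h := ((hd (r • v)).hasFDerivAt.comp_hasDerivAt r (hinner r))
    exact h.hasDerivWithinAt
  have hbound : ∀ r ∈ uIcc r₁ r₂, ‖fderiv ℝ (onM G) (r • v) v‖ ≤ bG := fun r hr => by
    refine ((fderiv ℝ (onM G) (r • v)).le_opNorm v).trans ?_
    rw [hv, norm_toLp_dir, mul_one, ← hv, hrv]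
    exact hb r hr
  have h := (convex_uIcc r₁ r₂).norm_image_sub_le_of_norm_hasDerivWithin_le hderiv hbound right_mem_uIcc left_mem_uIcc
  rw [hgr, hgr, Real.norm_eq_abs, Real.norm_eq_abs] at h
  exact h


section Generic

variable {a b : ℝ} (B : BandBounds a b) {δ : (Fin 2 → ℝ) → ℝ} {κ₀ κ₁ μ θ : ℝ}
  (hδ : ∀ k : Fin 2 → ℝ, (∀ i, |k i| ≤ π) → |δ k| ≤ κ₀) (hlo : a ≤ μ - κ₀) (hhi : μ + κ₀ ≤ b)
  (hL : ∀ s t : ℝ, s ∈ Icc 0 (π / ‖dir θ‖) → t ∈ Icc 0 (π / ‖dir θ‖) →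
    |δ (s • dir θ) - δ (t • dir θ)| ≤ κ₁ * |s - t|)
  (hκ₁ : κ₁ ≤ B.Dtmin)
include B hδ hlo hhi hL hκ₁

/-- **THE MONOTONE TUBE.**  On the ray `θ`, let `t` be a Fermi point of the perturbed band `ε₀ + δ` at level `μ` (`|δ| ≤ κ₀` on the closed
square, `[μ − κ₀, μ + κ₀] ⊂ [a, b]`, `δ` radially `κ₁`-Lipschitz with `κ₁ ≤ Dt_min`) and `s` a point of the segment whose free level lies in
`[a, b]`.  Then every `r` between `t` and `s` is a point of the segment with free level in `[a, b]`, and its perturbed level is at most that of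
`s` in absolute value: `|ε₀(r·dir θ) + δ(r·dir θ) − μ| ≤ |ε₀(s·dir θ) + δ(s·dir θ) − μ|` (the perturbed band is radially non-decreasing). -/
theorem abs_level_le_of_mem_uIcc {t : ℝ} (ht : IsBandFermiRadius (μ - δ (t • dir θ)) θ t) {s : ℝ} (hs0 : 0 ≤ s)
    (hs1 : s * ‖dir θ‖ ≤ π) (hs : rayDispersion (θ, s) ∈ Icc a b) {r : ℝ} (hr : r ∈ uIcc t s) :
    r ∈ Icc 0 (π / ‖dir θ‖) ∧ rayDispersion (θ, r) ∈ Icc a b ∧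
      |rayDispersion (θ, r) + δ (r • dir θ) - μ| ≤ |rayDispersion (θ, s) + δ (s • dir θ) - μ| := by
  have hm := shiftedLevel_mem_Icc ht hδ hlo hhi
  have htI := ht.mem_Icc
  have hsI : s ∈ Icc 0 (π / ‖dir θ‖) := mem_Icc_exit_iff.2 ⟨hs0, hs1⟩
  have hmono := strictMonoOn_rayDispersion_band θ
  have het : rayDispersion (θ, t) = μ - δ (t • dir θ) := ht.2
  have het' : rayDispersion (θ, t) + δ (t • dir θ) - μ = 0 := by rw [het]; ring
  have hrI : r ∈ Icc 0 (π / ‖dir θ‖) := by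
    rcases mem_uIcc.1 hr with h | h
    · exact ⟨htI.1.trans h.1, h.2.trans hsI.2⟩
    · exact ⟨hsI.1.trans h.1, h.2.trans htI.2⟩
  have hr1 : r * ‖dir θ‖ ≤ π := (mem_Icc_exit_iff.1 hrI).2
  have hat : a ≤ rayDispersion (θ, t) := by rw [het]; exact hm.1
  have hbt : rayDispersion (θ, t) ≤ b := by rw [het]; exact hm.2
  have hwin : rayDispersion (θ, r) ∈ Icc a b := by
    rcases mem_uIcc.1 hr with h | h
    · exact ⟨hat.trans (hmono.monotoneOn htI hrI h.1), (hmono.monotoneOn hrI hsI h.2).trans hs.2⟩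
    · exact ⟨hs.1.trans (hmono.monotoneOn hsI hrI h.1), (hmono.monotoneOn hrI htI h.2).trans hbt⟩
  refine ⟨hrI, hwin, ?_⟩
  have hlip_rt := abs_le.1 (hL r t hrI htI)
  have hlip_sr := abs_le.1 (hL s r hsI hrI)
  rcases mem_uIcc.1 hr with h | h
  · -- `t ≤ r ≤ s`: `0 ≤ e(r) ≤ e(s)`
    have g1 := Dtmin_mul_sub_le_rayDispersion_sub B htI.1 h.1 hr1 hat hwin.2
    have g2 := Dtmin_mul_sub_le_rayDispersion_sub B hrI.1 h.2 hs1 hwin.1 hs.2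
    have hart : |r - t| = r - t := abs_of_nonneg (sub_nonneg.2 h.1)
    have hasr : |s - r| = s - r := abs_of_nonneg (sub_nonneg.2 h.2)
    rw [hart] at hlip_rt
    rw [hasr] at hlip_sr
    have hp1 : 0 ≤ (B.Dtmin - κ₁) * (r - t) := mul_nonneg (sub_nonneg.2 hκ₁) (sub_nonneg.2 h.1)
    have hp2 : 0 ≤ (B.Dtmin - κ₁) * (s - r) := mul_nonneg (sub_nonneg.2 hκ₁) (sub_nonneg.2 h.2)
    have e0 : 0 ≤ rayDispersion (θ, r) + δ (r • dir θ) - μ := by nlinarith [hlip_rt.1, g1, het', hp1]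
    have e1 : rayDispersion (θ, r) + δ (r • dir θ) - μ ≤ rayDispersion (θ, s) + δ (s • dir θ) - μ := by
      nlinarith [hlip_sr.1, g2, hp2]
    rw [abs_of_nonneg e0, abs_of_nonneg (e0.trans e1)]
    exact e1
  · -- `s ≤ r ≤ t`: `e(s) ≤ e(r) ≤ 0`
    have g1 := Dtmin_mul_sub_le_rayDispersion_sub B hrI.1 h.2 ht.1.2 hwin.1 hbt
    have g2 := Dtmin_mul_sub_le_rayDispersion_sub B hs0 h.1 hr1 hs.1 hwin.2
    have hart : |r - t| = -(r - t) := abs_of_nonpos (sub_nonpos.2 h.2)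
    have hasr : |s - r| = -(s - r) := abs_of_nonpos (sub_nonpos.2 h.1)
    rw [hart] at hlip_rt
    rw [hasr] at hlip_sr
    have hp1 : 0 ≤ (B.Dtmin - κ₁) * (t - r) := mul_nonneg (sub_nonneg.2 hκ₁) (sub_nonneg.2 h.2)
    have hp2 : 0 ≤ (B.Dtmin - κ₁) * (r - s) := mul_nonneg (sub_nonneg.2 hκ₁) (sub_nonneg.2 h.1)
    have e0 : rayDispersion (θ, r) + δ (r • dir θ) - μ ≤ 0 := by nlinarith [hlip_rt.2, g1, het', hp1]
    have e1 : rayDispersion (θ, s) + δ (s • dir θ) - μ ≤ rayDispersion (θ, r) + δ (r • dir θ) - μ := by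
      nlinarith [hlip_sr.2, g2, hp2]
    rw [abs_of_nonpos e0, abs_of_nonpos (e1.trans e0)]
    linarith

end Generic

/-! ## §2 (E3e): reading off the curve with a gradient bound on the shell tube only -/

section OffCurveTube

variable {a b : ℝ} (B : BandBounds a b) {K : TrigPolyC4v} {A : ℝ}
  (hA : ∀ p : Momentum, ∀ j ≤ 2, ‖iteratedFDeriv ℝ j (frameShift K) p‖ ≤ A)
  (hADt : 2 * A < B.Dtmin) {μ Λ : ℝ} (hloΛ : a ≤ μ - A - Λ) (hhiΛ : μ + A + Λ ≤ b) (hΛ : 0 ≤ Λ)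
include B hA hADt hloΛ hhiΛ hΛ

/-- **Off-curve reading on the tube**: for a frame of `C²` size `A` with `2A < Dt_min` and `[μ − A − Λ, μ + A + Λ] ⊂ [a, b]`, a reading frame `S`
with `‖D(evalM S) q‖ ≤ b` at every `q` of the level tube `{|frameLevel μ K q| ≤ Λ}` (`b ≥ 0`), and a torus momentum with `|e_K(k⃗)| ≤ Λ`:
`|S(p_k⃗) − S(klFermiPoint μ K (θ(k⃗)))| ≤ b·|e_K(k⃗)|/(Dt_min − 2A)` — the radial segment from `p_k⃗` to its curve point lies in the tube. -/
theorem abs_eval_latticeMomentum_sub_eval_klFermiPoint_le_of_tube {L : ℕ} [NeZero L] (S : TrigPolyC4v) {bS : ℝ} (hbS : 0 ≤ bS)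
    (hS : ∀ q : Momentum, |frameLevel μ K q| ≤ Λ → ‖fderiv ℝ (evalM S) q‖ ≤ bS)
    {k : TorusSite 2 L} (hk : |nambuXiCT L μ K k| ≤ Λ) :
    |S.eval (latticeMomentum L k) - S.eval (klFermiPoint μ K (momentumAngle L k))| ≤
      bS * (|nambuXiCT L μ K k| / (B.Dtmin - 2 * A)) := by
  -- the centred representative in polar form
  set c : Fin 2 → ℝ := torusCentredMomentum L k with hc
  set θ : ℝ := polarAngle c with hθc
  set s : ℝ := ‖momToComplex c‖ with hs
  have hθ : momentumAngle L k = θ := rfl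
  have hpol : s • dir θ = c := (polar_repr c).symm
  have hs0 : 0 ≤ s := norm_nonneg _
  have hcn : ‖c‖ ≤ π := (pi_norm_le_iff_of_nonneg Real.pi_pos.le).2 fun i => by
    rw [Real.norm_eq_abs]; exact abs_torusCentredMomentum_le_pi L k i
  have hs1 : s * ‖dir θ‖ ≤ π := by rw [← norm_smul_dir hs0, hpol]; exact hcn
  have hSc : S.eval (latticeMomentum L k) = S.eval c := by
    have h := frameShift_toLp_torusCentredMomentum L S k
    rw [frameShift_toLp] at h
    linarith
  -- the perturbed level along the ray is `frameLevel μ K`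
  have hlevr : ∀ r : ℝ, rayDispersion (θ, r) + frameShift K (WithLp.toLp 2 (r • dir θ)) - μ =
      frameLevel μ K (WithLp.toLp 2 (r • dir θ)) := fun r => by
    have h1 : rayDispersion (θ, r) = sqDispersion (r • dir θ) := rfl
    rw [h1, frameLevel_toLp]
  have hlev : rayDispersion (θ, s) + frameShift K (WithLp.toLp 2 (s • dir θ)) - μ = nambuXiCT L μ K k := by
    have h1 : rayDispersion (θ, s) = sqDispersion (s • dir θ) := rfl
    rw [h1, hpol, nambuXiCT_eq_frameLevel, frameLevel_toLp]
  have hAk := abs_le.1 (abs_frameShift_toLp_le hA (s • dir θ))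
  have hek := abs_le.1 hk
  have hwin : rayDispersion (θ, s) ∈ Icc a b := by
    constructor <;> linarith [hlev]
  have hlo : a ≤ μ - A := by linarith
  have hhi : μ + A ≤ b := by linarith
  have hδb : ∀ k : Fin 2 → ℝ, (∀ i, |k i| ≤ π) → |(fun k : Fin 2 → ℝ => frameShift K (WithLp.toLp 2 k)) k| ≤ A :=
    fun k _ => abs_frameShift_toLp_le hA k
  have ht := isBandFermiRadius_perturbedFermiRadius_frame B hA hlo hhi θ
  set u := perturbedFermiRadius (fun k : Fin 2 → ℝ => frameShift K (WithLp.toLp 2 k)) μ θ with hu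
  -- the gradient on the radial segment, via the monotone tube
  have hseg : ∀ r ∈ uIcc u s, ‖fderiv ℝ (onM (fun p : Fin 2 → ℝ => S.eval p)) (WithLp.toLp 2 (r • dir θ))‖ ≤ bS := by
    intro r hr
    have hmt := abs_level_le_of_mem_uIcc B hδb hlo hhi (radialLipschitz_frameShift hA θ) hADt.le ht hs0 hs1 hwin hr
    have hlev_r : |frameLevel μ K (WithLp.toLp 2 (r • dir θ))| ≤ Λ := by
      rw [← hlevr r]
      exact hmt.2.2.trans (by rw [hlev]; exact hk)
    exact hS _ hlev_r
  have hmvt := abs_sub_le_of_norm_fderiv_onM_le_uIcc (G := fun p : Fin 2 → ℝ => S.eval p) (differentiable_evalM S) θ u s hseg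
  have hdist := abs_sub_perturbedFermiRadius_le_abs_level B (continuous_frameShift_toLp K) hδb hlo hhi
    (radialLipschitz_frameShift hA θ) hADt hs0 hs1 hwin
  rw [hSc, hθ, klFermiPoint_eq, ← hpol]
  calc |S.eval (s • dir θ) - S.eval (u • dir θ)| ≤ bS * |s - u| := by
        rw [abs_sub_comm, abs_sub_comm s u]; exact hmvt
    _ ≤ bS * (|nambuXiCT L μ K k| / (B.Dtmin - 2 * A)) := by
        refine mul_le_mul_of_nonneg_left ?_ hbS
        rw [← hlev]
        exact hdist

end OffCurveTube

section Model

variable {L M : ℕ} [NeZero L] [NeZero M]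

/-- **SUPPLIER of (E3d/e) `TwoLegSlopes` from the field strength and a gradient bound ON THE SHELL TUBE ONLY.**  As
`twoLegSlopes_of_fieldStrength_of_gradient`, but the gradient of `evalM S_n`, `S_n = symInterp L (klLocSelfEnergyRe … n)`, is asked only at the
momenta `q` with `|frameLevel μ K q| ≤ Λ_n = klScale klE0 n` (the shell's continuum tube): `‖D(evalM S_n) q‖ ≤ b` there, `0 ≤ b ≤ cz·|U|·(Dt_min − 2A)`,
field strength `|z_n − 1| ≤ cz|U|` on the shell, (E0) at scale `n` ⇒ `TwoLegSlopes R … K n`. -/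
theorem twoLegSlopes_of_fieldStrength_of_tubeGradient {a b : ℝ} (B : BandBounds a b) {K : TrigPolyC4v} {A : ℝ}
    (hA : ∀ p : Momentum, ∀ j ≤ 2, ‖iteratedFDeriv ℝ j (frameShift K) p‖ ≤ A) (hADt : 2 * A < B.Dtmin)
    {R : RenConsts} {β U μ : ℝ} {n : ℕ}
    (hloΛ : a ≤ μ - A - klScale klE0 n) (hhiΛ : μ + A + klScale klE0 n ≤ b)
    (hE0 : SelfEnergySymmetric L M β U μ K n)
    (hz : ∀ k ∈ klShell L μ K n, |klFieldStrength L M β U μ K n k - 1| ≤ R.cz * |U|)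
    {bS : ℝ} (hbS : 0 ≤ bS)
    (hgrad : ∀ q : Momentum, |frameLevel μ K q| ≤ klScale klE0 n →
      ‖fderiv ℝ (evalM (symInterp L (klLocSelfEnergyRe L M β U μ K n))) q‖ ≤ bS)
    (hb : bS ≤ R.cz * |U| * (B.Dtmin - 2 * A)) :
    TwoLegSlopes L M R β U μ K n := by
  intro k hk
  refine ⟨hz k hk, ?_⟩
  have hkΛ : |nambuXiCT L μ K k| ≤ klScale klE0 n := by
    rw [klShell, mem_momentumShell] at hk; exact hk
  have hpos : 0 < B.Dtmin - 2 * A := sub_pos.2 hADt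
  set S := symInterp L (klLocSelfEnergyRe L M β U μ K n) with hSdef
  have hread := abs_eval_latticeMomentum_sub_eval_klFermiPoint_le_of_tube B hA hADt hloΛ hhiΛ
    (by unfold klScale klE0; positivity) S hbS hgrad hkΛ
  rw [eval_symInterp_klLocSelfEnergyRe_latticeMomentum hE0] at hread
  have hloc : klLocalPart L M β U μ K n (momentumAngle L k) = S.eval (klFermiPoint μ K (momentumAngle L k)) := rfl
  rw [hloc]
  refine hread.trans ?_
  rw [mul_div_assoc', div_le_iff₀ hpos]
  have he : 0 ≤ |nambuXiCT L μ K k| := abs_nonneg _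
  calc bS * |nambuXiCT L μ K k| ≤ R.cz * |U| * (B.Dtmin - 2 * A) * |nambuXiCT L μ K k| :=
        mul_le_mul_of_nonneg_right hb he
    _ = R.cz * |U| * |nambuXiCT L μ K k| * (B.Dtmin - 2 * A) := by ring

end Model

/-! ## §3 (E3c): the two-frame reading split with a gradient bound on the frame-distance tube only -/

section TwoFramesTube

variable {a b : ℝ} (B : BandBounds a b) {K K' : TrigPolyC4v} {A : ℝ}
  (hA : ∀ p : Momentum, ∀ j ≤ 2, ‖iteratedFDeriv ℝ j (frameShift K) p‖ ≤ A)
  (hA' : ∀ p : Momentum, ∀ j ≤ 2, ‖iteratedFDeriv ℝ j (frameShift K') p‖ ≤ A)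
  (hADt : 2 * A < B.Dtmin) {μ : ℝ} (hlo : a ≤ μ - A) (hhi : μ + A ≤ b)
include B hA hA' hADt hlo hhi

/-- **(E3c)'s reading split on the tube**: for a profile function `G : FrameFn` with `onM G` differentiable and `‖D(onM G) q‖ ≤ b` at every `q`
with `|frameLevel μ K q| ≤ frameDist K K′` (`b ≥ 0`), and any second function `G′`:
`|G(k_F^K θ) − G′(k_F^{K′} θ)| ≤ |G(k_F^{K′} θ) − G′(k_F^{K′} θ)| + b·frameDist K K′/(Dt_min − 2A)`.  (Both Fermi points lie on the ray `θ`; the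
`K`-levels on the radial segment between them lie between `0` and `e_K(k_F^{K′}θ) = (K′ − K)(k_F^{K′}θ)`, of size `≤ frameDist K K′`.) -/
theorem abs_apply_klFermiPoint_sub_le_of_frames_of_tube (G G' : FrameFn) (hG : Differentiable ℝ (onM G)) {bG : ℝ} (hbG : 0 ≤ bG)
    (θ : ℝ) (hgrad : ∀ q : Momentum, |frameLevel μ K q| ≤ frameDist K K' → ‖fderiv ℝ (onM G) q‖ ≤ bG) :
    |G (klFermiPoint μ K θ) - G' (klFermiPoint μ K' θ)| ≤
      |G (klFermiPoint μ K' θ) - G' (klFermiPoint μ K' θ)| + bG * (frameDist K K' / (B.Dtmin - 2 * A)) := by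
  have hδb : ∀ k : Fin 2 → ℝ, (∀ i, |k i| ≤ π) → |(fun k : Fin 2 → ℝ => frameShift K (WithLp.toLp 2 k)) k| ≤ A :=
    fun k _ => abs_frameShift_toLp_le hA k
  have hδb' : ∀ k : Fin 2 → ℝ, (∀ i, |k i| ≤ π) → |(fun k : Fin 2 → ℝ => frameShift K' (WithLp.toLp 2 k)) k| ≤ A :=
    fun k _ => abs_frameShift_toLp_le hA' k
  have ht := isBandFermiRadius_perturbedFermiRadius_frame B hA hlo hhi θ
  have ht' := isBandFermiRadius_perturbedFermiRadius_frame B hA' hlo hhi θ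
  set u := perturbedFermiRadius (fun k : Fin 2 → ℝ => frameShift K (WithLp.toLp 2 k)) μ θ with hu
  set u' := perturbedFermiRadius (fun k : Fin 2 → ℝ => frameShift K' (WithLp.toLp 2 k)) μ θ with hu'
  have hm' := shiftedLevel_mem_Icc ht' hδb' hlo hhi
  have hwin : rayDispersion (θ, u') ∈ Icc a b := by rw [ht'.2]; exact hm'
  -- the `K`-level at `K′`'s Fermi point is `(K′ − K)` there, of size `≤ frameDist K K′`
  have hlev' : rayDispersion (θ, u') + frameShift K (WithLp.toLp 2 (u' • dir θ)) - μ =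
      K'.eval (u' • dir θ) - K.eval (u' • dir θ) := by
    rw [ht'.2, frameShift_toLp, frameShift_toLp]; ring
  have hlevb : |rayDispersion (θ, u') + frameShift K (WithLp.toLp 2 (u' • dir θ)) - μ| ≤ frameDist K K' := by
    rw [hlev', frameDist_comm]; exact abs_eval_sub_le_frameDist K' K _
  have hlevr : ∀ r : ℝ, rayDispersion (θ, r) + frameShift K (WithLp.toLp 2 (r • dir θ)) - μ =
      frameLevel μ K (WithLp.toLp 2 (r • dir θ)) := fun r => by
    have h1 : rayDispersion (θ, r) = sqDispersion (r • dir θ) := rfl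
    rw [h1, frameLevel_toLp]
  -- the gradient on the radial segment between the two Fermi radii
  have hseg : ∀ r ∈ uIcc u u', ‖fderiv ℝ (onM G) (WithLp.toLp 2 (r • dir θ))‖ ≤ bG := by
    intro r hr
    have hmt := abs_level_le_of_mem_uIcc B hδb hlo hhi (radialLipschitz_frameShift hA θ) hADt.le ht ht'.1.1 ht'.1.2 hwin hr
    have hlev_r : |frameLevel μ K (WithLp.toLp 2 (r • dir θ))| ≤ frameDist K K' := by
      rw [← hlevr r]; exact hmt.2.2.trans hlevb
    exact hgrad _ hlev_r
  have hmvt := abs_sub_le_of_norm_fderiv_onM_le_uIcc hG θ u u' hseg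
  have hrad := abs_klFermiRadius_sub_le_frameDist B hA hA' hADt hlo hhi θ
  have h1 : |G (u • dir θ) - G (u' • dir θ)| ≤ bG * (frameDist K K' / (B.Dtmin - 2 * A)) :=
    hmvt.trans (mul_le_mul_of_nonneg_left hrad hbG)
  rw [klFermiPoint_eq, klFermiPoint_eq]
  calc |G (u • dir θ) - G' (u' • dir θ)|
      = |(G (u • dir θ) - G (u' • dir θ)) + (G (u' • dir θ) - G' (u' • dir θ))| := by ring_nf
    _ ≤ |G (u • dir θ) - G (u' • dir θ)| + |G (u' • dir θ) - G' (u' • dir θ)| := abs_add_le _ _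
    _ ≤ _ := by linarith

end TwoFramesTube

end Summit.HubbardSuperconductivity.HubbardSuperconductivity.Theorems.KLRegimeSplit

end
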